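import Literature.Probability.Percolation.ClusterConditionalCovariance
import Literature.Probability.Percolation.DecisionTreeWeightedMeasure
import Literature.Probability.Percolation.PercolationEvents
import HarnessLib

/-!
# The halving lemma (v): the RESAMPLING IDENTITY for the Harris gap and the boundary relaxation (W)
# (Sahi programme, prover prim-sahi-p2 gen 47)

Support file (`--supports stmt-CriticalPhenomena-4575`, helper).  No definitions, no named facts, no sorries; standard axioms.
Memo `run/shared/lean/prim/prim-sahi/FROM-prim-sahi-p2-gen47-RESAMPLING.md`; `prim-sahi-p2/PROOF-E3.md` §57.

SETTING.  Bernoulli bond percolation `μ = prodBernoulli w` with arbitrary pair weights on a finite vertex type `V` (every pair a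
coordinate); three vertices `s, a, c`; `U = {s ↔ a} ∪ {c ↔ a}`, `D = {s ↮ c}`.  The HALVING LEMMA (v) of the C5-chord line is
`μ(U)·μ(D) ≤ 2·μ(U ∩ D)` (memos gen 42–46; OPEN in general).  Write `Ī = Uᶜ = {a ↮ s, a ↮ c}`, `SC = {s ↔ c}`; the Harris gap is
`μ(U)μ(D) − μ(U ∩ D) = μ(Ī)μ(SC) − μ(Ī ∩ SC)`.

WHAT IS PROVED HERE (every finite weighted graph, every `s a c`; finite sums `Σ_K wtW K …` over configurations `K ⊆ Sym2 V`
with Gladkov's Bernoulli weights `DecisionTree.wtW`, bridged to `prodBernoulli` by `DecisionTree.prodBernoulli_real_eq_PrW`).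
* `conn_cohybrid_meets` — the PATH LEMMA: let `F` be a set of pairs each meeting the open cluster of `a` in `K`, and let `θ` be
  the configuration equal to `C` on `F` and to `K` off `F` (`splice F C K`).  If `a ↮ s` in `K`, `s ↮ c` in `K` but `s ↔ c` in `θ`,
  then `C` contains a pair `s(x,y)` with `a ↔ x` and `s ↔ y` in `K` (an OPEN pair of `C` between the cluster of `a` and the cluster
  of `s`).  (First boundary dart of an `s–c` walk in `θ` leaving the set of vertices joined to `s` by pairs of `K` off `F`.)
* **`real_notU_mul_real_conn_eq`** — the RESAMPLING IDENTITY
  `μ(Ī)·μ(SC) = Σ_K wtW K · 1_Ī(K) · Σ_C wtW C · 1_SC(splice S(K) C K)`,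
  `S(K)` = the set of pairs revealed by the exploration of the open cluster of `a` in `K` (`TargetExploration.revealedAt univ ∅ a`):
  "`μ(Ī)μ(SC)` is the probability that, starting from a configuration with `a ↮ s, c` and RE-RANDOMISING the pairs at the cluster of
  `a`, one sees `s ↔ c`".  It is Gladkov's swap (Lemma 3.1, tree: `DecisionTree.sum_pair_reindexW` along the self-determined
  revealed set, `TargetExploration.selfDetermined_revealedAt`) applied to `f(K,C) = 1_Ī(K)·1_SC(C)`, plus "the hybrid keeps the
  cluster of `a`" (`ClusterConditioning.reachable_hybrid_iff`).
* **`gap_le_boundaryResample`** — `μ(Ī)μ(SC) − μ(Ī ∩ SC) ≤ Λ`, where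
  `Λ := Σ_K Σ_C wtW K · wtW C · 1[K ∈ s|a|c ; C has a pair between C_a(K) and C_s(K) ; C has a pair between C_a(K) and C_c(K)]`
  (for `K ∈ Ī ∩ SC` the re-randomised configuration still has `s ↔ c`; for `K ∈ s|a|c` the path lemma applies at both ends).
* **`halvingUD_of_boundaryResample`** — the REDUCTION: if `Λ ≤ μ(U ∩ D)` (the relaxation (W) of the memo: numerically
  `Λ ≤ 0.33·μ(U ∩ D)` everywhere tested, two-copy fibre-positive on `K₄…K₆`) then the halving lemma `μ(U)μ(D) ≤ 2μ(U ∩ D)` holds.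
Nothing here is conditional on an unproved fact: (W) enters only as the hypothesis of the last theorem.
-/

noncomputable section

open Classical

namespace Summit.CriticalPhenomena.PercolationContinuityZ3.Theorems

namespace HalvingResample

open Finset MeasureTheory
open Literature.Probability.Percolation Literature.Probability.Percolation.DecisionTree
open Literature.Probability.Percolation.TargetExploration Literature.Probability.Percolation.ClusterConditioning
open Literature.Probability.LatticeModels

variable {V : Type*} [Fintype V]

/-! ### The path lemma -/

omit [Fintype V] in
/-- **Path lemma.**  `F` a set of pairs each meeting the open cluster of `a` in `K`; `θ = splice F C K` (`C` on `F`, `K` off `F`).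
If `a ↮ s` and `s ↮ c` in `K` but `s ↔ c` in `θ`, then `C` has a pair `s(x,y)` with `a ↔ x` and `s ↔ y` in `K`
(an open pair of `C` between the clusters of `a` and of `s`): the first dart of an `s–c` walk of `θ` leaving the set of
vertices joined to `s` by pairs of `K` off `F`. [this work] -/
theorem conn_cohybrid_meets {F K C : Finset (Sym2 V)} {a s c : V}
    (hF : ∀ e ∈ F, ∃ u ∈ e, (openGraph (↑K : Set (Sym2 V))).Reachable a u)
    (has : ¬ (openGraph (↑K : Set (Sym2 V))).Reachable a s)
    (hsc : ¬ (openGraph (↑K : Set (Sym2 V))).Reachable s c)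
    (hθ : (openGraph (↑(splice F C K) : Set (Sym2 V))).Reachable s c) :
    ∃ e ∈ C, ∃ x y : V, e = s(x, y) ∧ (openGraph (↑K : Set (Sym2 V))).Reachable a x ∧
      (openGraph (↑K : Set (Sym2 V))).Reachable s y := by
  -- the vertices joined to `s` by pairs of `K` off `F`
  set S : Set V := {v | (openGraph (↑(K \ F) : Set (Sym2 V))).Reachable s v} with hS
  have hKF : (↑(K \ F) : Set (Sym2 V)) ⊆ ↑K := Finset.coe_subset.2 Finset.sdiff_subset
  have hsS : s ∈ S := SimpleGraph.Reachable.refl s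
  have hcS : c ∉ S := fun h => hsc (h.mono (openGraph_mono hKF))
  obtain ⟨p⟩ := hθ
  obtain ⟨d, -, hd1, hd2⟩ := p.exists_boundary_dart S hsS hcS
  have hadj := d.adj
  rw [openGraph_adj] at hadj
  obtain ⟨hmem, hne⟩ := hadj
  have hmem' : s(d.toProd.1, d.toProd.2) ∈ splice F C K := Finset.mem_coe.1 hmem
  -- `x = d.fst ∈ S` is joined to `s` in `K`, hence not to `a`
  have hx : (openGraph (↑K : Set (Sym2 V))).Reachable s d.toProd.1 := hd1.mono (openGraph_mono hKF)
  by_cases heF : s(d.toProd.1, d.toProd.2) ∈ F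
  · -- the dart's pair is in `F`, hence in `C`, and meets the cluster of `a` at its far end
    have heC : s(d.toProd.1, d.toProd.2) ∈ C := (mem_splice_of_mem heF).1 hmem'
    obtain ⟨u, hu, hau⟩ := hF _ heF
    rcases Sym2.mem_iff.1 hu with rfl | rfl
    · exact absurd (hau.trans hx.symm) has
    · exact ⟨_, heC, d.toProd.2, d.toProd.1, Sym2.eq_swap, hau, hx⟩
  · -- the dart's pair is off `F`, hence in `K \ F`: its far end is in `S`, contradiction
    have heK : s(d.toProd.1, d.toProd.2) ∈ K := (mem_splice_of_not_mem heF).1 hmem'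
    have hadj' : (openGraph (↑(K \ F) : Set (Sym2 V))).Adj d.toProd.1 d.toProd.2 := by
      rw [openGraph_adj]
      exact ⟨Finset.mem_coe.2 (Finset.mem_sdiff.2 ⟨heK, heF⟩), hne⟩
    exact absurd (hd1.trans hadj'.reachable) hd2

/-! ### The resampling identity -/

/-- **Resampling identity** (Gladkov's swap along the revealed set of the cluster exploration of `a`, applied to
`f(K,C) = 1[a ↮ s,c in K]·1[s ↔ c in C]`): with `p_e = w_e` and `S(K) = revealedAt univ ∅ a K`,
`(Σ_K wtW K·1_Ī(K))·(Σ_C wtW C·1_SC(C)) = Σ_K Σ_C wtW K·wtW C·1_Ī(K)·1_SC(splice S(K) C K)`. [this work] (the swap is Gladkov 2024, Lemma 3.1, in the tree as `DecisionTree.sum_pair_reindexW`) -/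
theorem sum_notU_mul_sum_conn_eq (p : Sym2 V → ℝ) (s a c : V) :
    (∑ K ∈ (Finset.univ : Finset (Sym2 V)).powerset, wtW Finset.univ p K *
        ind {K : Finset (Sym2 V) | ¬ (openGraph (↑K : Set (Sym2 V))).Reachable a s ∧
          ¬ (openGraph (↑K : Set (Sym2 V))).Reachable a c} K) *
      (∑ C ∈ (Finset.univ : Finset (Sym2 V)).powerset, wtW Finset.univ p C *
        ind {C : Finset (Sym2 V) | (openGraph (↑C : Set (Sym2 V))).Reachable s c} C) =
    ∑ K ∈ (Finset.univ : Finset (Sym2 V)).powerset, ∑ C ∈ (Finset.univ : Finset (Sym2 V)).powerset,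
      wtW Finset.univ p K * wtW Finset.univ p C *
        (ind {K : Finset (Sym2 V) | ¬ (openGraph (↑K : Set (Sym2 V))).Reachable a s ∧
            ¬ (openGraph (↑K : Set (Sym2 V))).Reachable a c} K *
          ind {C : Finset (Sym2 V) | (openGraph (↑C : Set (Sym2 V))).Reachable s c}
            (splice (revealedAt (Finset.univ : Finset (Sym2 V)) (∅ : Finset V) a K) C K)) := by
  set D : Finset (Sym2 V) := Finset.univ with hD
  set Ib : Set (Finset (Sym2 V)) := {K | ¬ (openGraph (↑K : Set (Sym2 V))).Reachable a s ∧
      ¬ (openGraph (↑K : Set (Sym2 V))).Reachable a c} with hIb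
  set SC : Set (Finset (Sym2 V)) := {C | (openGraph (↑C : Set (Sym2 V))).Reachable s c} with hSC
  have hF := selfDetermined_revealedAt (D := D) (A := (∅ : Finset V)) (o := a)
  have h := sum_pair_reindexW D p hF (fun x => ind Ib x.1 * ind SC x.2)
  rw [Finset.sum_mul_sum, ← Finset.sum_product']
  have hl : ∑ x ∈ D.powerset ×ˢ D.powerset, wtW D p x.1 * ind Ib x.1 * (wtW D p x.2 * ind SC x.2) =
      ∑ x ∈ D.powerset ×ˢ D.powerset, wt2W D p x * (ind Ib x.1 * ind SC x.2) := by
    refine Finset.sum_congr rfl fun x _ => ?_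
    simp only [wt2W]; ring
  rw [hl, h, Finset.sum_product]
  refine Finset.sum_congr rfl fun K _ => Finset.sum_congr rfl fun C _ => ?_
  -- the first component of the swap keeps the cluster of `a`
  have h1 : ind Ib (swapPair (revealedAt D (∅ : Finset V) a) (K, C)).1 = ind Ib K := by
    have hiff : (swapPair (revealedAt D (∅ : Finset V) a) (K, C)).1 ∈ Ib ↔ K ∈ Ib := by
      simp only [swapPair, hIb, Set.mem_setOf_eq, hD, reachable_hybrid_iff]
    by_cases hK : K ∈ Ib
    · rw [ind_of_mem hK, ind_of_mem (hiff.2 hK)]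
    · rw [ind_of_not_mem hK, ind_of_not_mem (fun h => hK (hiff.1 h))]
  have h2 : (swapPair (revealedAt D (∅ : Finset V) a) (K, C)).2 = splice (revealedAt D (∅ : Finset V) a K) C K := rfl
  simp only [wt2W, h1, h2]

/-! ### The boundary relaxation bounds the gap -/

/-- **The resampling bound** `μ(Ī)·μ(SC) ≤ μ(Ī ∩ SC) + Λ` in finite-sum form: for `K ∈ Ī ∩ SC` the re-randomised configuration
is counted by `1`; for `K ∈ s|a|c` an `s–c` connection of `splice S(K) C K` forces `C` to have a pair between `C_a(K)` and `C_s(K)`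
and one between `C_a(K)` and `C_c(K)` (`conn_cohybrid_meets` at both ends; the revealed pairs meet the cluster of `a`,
`ClusterConditioning.exists_reachable_of_mem_revealedAt`). [this work] -/
theorem sum_notU_mul_sum_conn_le {p : Sym2 V → ℝ} (hp0 : ∀ e, 0 ≤ p e) (hp1 : ∀ e, p e ≤ 1) (s a c : V) :
    (∑ K ∈ (Finset.univ : Finset (Sym2 V)).powerset, wtW Finset.univ p K *
        ind {K : Finset (Sym2 V) | ¬ (openGraph (↑K : Set (Sym2 V))).Reachable a s ∧
          ¬ (openGraph (↑K : Set (Sym2 V))).Reachable a c} K) *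
      (∑ C ∈ (Finset.univ : Finset (Sym2 V)).powerset, wtW Finset.univ p C *
        ind {C : Finset (Sym2 V) | (openGraph (↑C : Set (Sym2 V))).Reachable s c} C) ≤
    (∑ K ∈ (Finset.univ : Finset (Sym2 V)).powerset, wtW Finset.univ p K *
        ind {K : Finset (Sym2 V) | (¬ (openGraph (↑K : Set (Sym2 V))).Reachable a s ∧
          ¬ (openGraph (↑K : Set (Sym2 V))).Reachable a c) ∧ (openGraph (↑K : Set (Sym2 V))).Reachable s c} K) +
    ∑ K ∈ (Finset.univ : Finset (Sym2 V)).powerset, ∑ C ∈ (Finset.univ : Finset (Sym2 V)).powerset,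
      wtW Finset.univ p K * wtW Finset.univ p C *
        ind {x : Finset (Sym2 V) × Finset (Sym2 V) |
            (¬ (openGraph (↑x.1 : Set (Sym2 V))).Reachable a s ∧ ¬ (openGraph (↑x.1 : Set (Sym2 V))).Reachable a c ∧
                ¬ (openGraph (↑x.1 : Set (Sym2 V))).Reachable s c) ∧
              (∃ e ∈ x.2, ∃ u v : V, e = s(u, v) ∧ (openGraph (↑x.1 : Set (Sym2 V))).Reachable a u ∧
                (openGraph (↑x.1 : Set (Sym2 V))).Reachable s v) ∧
              (∃ e ∈ x.2, ∃ u v : V, e = s(u, v) ∧ (openGraph (↑x.1 : Set (Sym2 V))).Reachable a u ∧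
                (openGraph (↑x.1 : Set (Sym2 V))).Reachable c v)} (K, C) := by
  set D : Finset (Sym2 V) := Finset.univ with hD
  set Ib : Set (Finset (Sym2 V)) := {K | ¬ (openGraph (↑K : Set (Sym2 V))).Reachable a s ∧
      ¬ (openGraph (↑K : Set (Sym2 V))).Reachable a c} with hIb
  set SC : Set (Finset (Sym2 V)) := {C | (openGraph (↑C : Set (Sym2 V))).Reachable s c} with hSC
  set J3 : Set (Finset (Sym2 V)) := {K | (¬ (openGraph (↑K : Set (Sym2 V))).Reachable a s ∧
      ¬ (openGraph (↑K : Set (Sym2 V))).Reachable a c) ∧ (openGraph (↑K : Set (Sym2 V))).Reachable s c} with hJ3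
  set Lam : Set (Finset (Sym2 V) × Finset (Sym2 V)) := {x |
      (¬ (openGraph (↑x.1 : Set (Sym2 V))).Reachable a s ∧ ¬ (openGraph (↑x.1 : Set (Sym2 V))).Reachable a c ∧
          ¬ (openGraph (↑x.1 : Set (Sym2 V))).Reachable s c) ∧
        (∃ e ∈ x.2, ∃ u v : V, e = s(u, v) ∧ (openGraph (↑x.1 : Set (Sym2 V))).Reachable a u ∧
          (openGraph (↑x.1 : Set (Sym2 V))).Reachable s v) ∧
        (∃ e ∈ x.2, ∃ u v : V, e = s(u, v) ∧ (openGraph (↑x.1 : Set (Sym2 V))).Reachable a u ∧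
          (openGraph (↑x.1 : Set (Sym2 V))).Reachable c v)} with hLam
  rw [sum_notU_mul_sum_conn_eq p s a c]
  -- pointwise bound of the integrand
  have hpt : ∀ K C : Finset (Sym2 V),
      ind Ib K * ind SC (splice (revealedAt D (∅ : Finset V) a K) C K) ≤ ind J3 K + ind Lam (K, C) := by
    intro K C
    have hL0 : 0 ≤ ind Lam (K, C) := by unfold ind; split_ifs <;> norm_num
    have hJ0 : 0 ≤ ind J3 K := by unfold ind; split_ifs <;> norm_num
    by_cases hK : K ∈ Ib
    · rw [ind_of_mem hK, one_mul]
      by_cases hKsc : (openGraph (↑K : Set (Sym2 V))).Reachable s c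
      · have hJ : K ∈ J3 := ⟨hK, hKsc⟩
        rw [ind_of_mem hJ]
        have : ind SC (splice (revealedAt D (∅ : Finset V) a K) C K) ≤ 1 := by unfold ind; split_ifs <;> norm_num
        linarith
      · by_cases hθ : splice (revealedAt D (∅ : Finset V) a K) C K ∈ SC
        · -- the path lemma at both ends
          have hFa : ∀ e ∈ revealedAt D (∅ : Finset V) a K, ∃ u ∈ e, (openGraph (↑K : Set (Sym2 V))).Reachable a u :=
            fun e he => by rw [hD] at he; exact exists_reachable_of_mem_revealedAt he
          have hθ' : (openGraph (↑(splice (revealedAt D (∅ : Finset V) a K) C K) : Set (Sym2 V))).Reachable s c := hθ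
          obtain ⟨e1, he1, u1, v1, he1', hau1, hsv1⟩ := conn_cohybrid_meets hFa hK.1 hKsc hθ'
          obtain ⟨e2, he2, u2, v2, he2', hau2, hcv2⟩ :=
            conn_cohybrid_meets hFa hK.2 (fun h => hKsc h.symm) hθ'.symm
          have hmem : (K, C) ∈ Lam := ⟨⟨hK.1, hK.2, hKsc⟩, ⟨e1, he1, u1, v1, he1', hau1, hsv1⟩, ⟨e2, he2, u2, v2, he2', hau2, hcv2⟩⟩
          rw [ind_of_mem hθ, ind_of_mem hmem]
          linarith
        · rw [ind_of_not_mem hθ]; linarith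
    · rw [ind_of_not_mem hK, zero_mul]; linarith
  -- sum it up
  have hw0 : ∀ K : Finset (Sym2 V), 0 ≤ wtW D p K := fun K => wtW_nonneg D hp0 hp1 K
  calc ∑ K ∈ D.powerset, ∑ C ∈ D.powerset, wtW D p K * wtW D p C *
          (ind Ib K * ind SC (splice (revealedAt D (∅ : Finset V) a K) C K))
      ≤ ∑ K ∈ D.powerset, ∑ C ∈ D.powerset, wtW D p K * wtW D p C * (ind J3 K + ind Lam (K, C)) := by
        refine Finset.sum_le_sum fun K _ => Finset.sum_le_sum fun C _ => ?_
        exact mul_le_mul_of_nonneg_left (hpt K C) (mul_nonneg (hw0 K) (hw0 C))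
    _ = (∑ K ∈ D.powerset, wtW D p K * ind J3 K) * (∑ C ∈ D.powerset, wtW D p C) +
          ∑ K ∈ D.powerset, ∑ C ∈ D.powerset, wtW D p K * wtW D p C * ind Lam (K, C) := by
        rw [Finset.sum_mul_sum, ← Finset.sum_add_distrib]
        refine Finset.sum_congr rfl fun K _ => ?_
        rw [← Finset.sum_add_distrib]
        refine Finset.sum_congr rfl fun C _ => ?_
        ring
    _ = _ := by rw [sum_wtW, mul_one]

/-! ### The reduction: (W) ⟹ the halving lemma (v) -/

/-- **The halving lemma from the boundary relaxation (W).**  `μ = prodBernoulli w`, `U = {s↔a} ∪ {c↔a}`, `D = {s↮c}`.  If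
`Λ := Σ_K Σ_C wtW K · wtW C · 1[a|s|c in K ; C has a pair between C_a(K) and C_s(K) ; C has a pair between C_a(K) and C_c(K)]`
is at most `μ(U ∩ D)` — the relaxation (W) of memo gen 47, i.e. "from `s|a|c`, one fresh layer of pairs at the cluster of `a`
reconnects both `s` and `c` with probability at most `μ(a joined to exactly one of s, c)`" — then `μ(U)·μ(D) ≤ 2·μ(U ∩ D)`.
Proof: `μ(U)μ(D) − 2μ(U∩D) = [μ(Ī)μ(SC) − μ(Ī∩SC)] − μ(U∩D) ≤ Λ − μ(U∩D) ≤ 0` by `sum_notU_mul_sum_conn_le`. [this work] -/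
theorem halvingUD_of_boundaryResample (w : Sym2 V → unitInterval) (s a c : V)
    (hW : ∑ K ∈ (Finset.univ : Finset (Sym2 V)).powerset, ∑ C ∈ (Finset.univ : Finset (Sym2 V)).powerset,
        wtW Finset.univ (fun e => (w e : ℝ)) K * wtW Finset.univ (fun e => (w e : ℝ)) C *
          ind {x : Finset (Sym2 V) × Finset (Sym2 V) |
              (¬ (openGraph (↑x.1 : Set (Sym2 V))).Reachable a s ∧ ¬ (openGraph (↑x.1 : Set (Sym2 V))).Reachable a c ∧
                  ¬ (openGraph (↑x.1 : Set (Sym2 V))).Reachable s c) ∧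
                (∃ e ∈ x.2, ∃ u v : V, e = s(u, v) ∧ (openGraph (↑x.1 : Set (Sym2 V))).Reachable a u ∧
                  (openGraph (↑x.1 : Set (Sym2 V))).Reachable s v) ∧
                (∃ e ∈ x.2, ∃ u v : V, e = s(u, v) ∧ (openGraph (↑x.1 : Set (Sym2 V))).Reachable a u ∧
                  (openGraph (↑x.1 : Set (Sym2 V))).Reachable c v)} (K, C) ≤
      (prodBernoulli w).real ((openConn s a ∪ openConn c a) ∩ (openConn s c)ᶜ)) :
    (prodBernoulli w).real (openConn s a ∪ openConn c a) * (prodBernoulli w).real ((openConn s c)ᶜ) ≤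
      2 * (prodBernoulli w).real ((openConn s a ∪ openConn c a) ∩ (openConn s c)ᶜ) := by
  set D : Finset (Sym2 V) := Finset.univ with hD
  set p : Sym2 V → ℝ := fun e => (w e : ℝ) with hp
  have hp0 : ∀ e, 0 ≤ p e := fun e => (w e).2.1
  have hp1 : ∀ e, p e ≤ 1 := fun e => (w e).2.2
  have hdet : ∀ E : Set (BondConfig V), DeterminedBy E (↑D : Set (Sym2 V)) := by
    intro E
    rw [determinedBy_iff]
    intro ω ω' h
    rw [hD, Finset.coe_univ, Set.inter_univ, Set.inter_univ] at h
    rw [h]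
  -- the three measures as finite sums
  set U : Set (BondConfig V) := openConn s a ∪ openConn c a with hU
  set Dv : Set (BondConfig V) := (openConn s c)ᶜ with hDv
  have eU : (prodBernoulli w).real U = ∑ K ∈ D.powerset, wtW D p K * ind {K : Finset (Sym2 V) | (↑K : Set (Sym2 V)) ∈ U} K := by
    rw [DecisionTree.prodBernoulli_real_eq_PrW w (hdet U) (X := {K : Finset (Sym2 V) | (↑K : Set (Sym2 V)) ∈ U})
      (fun S _ => Iff.rfl), PrW_eq_sum_ind]
  have eD : (prodBernoulli w).real Dv = ∑ K ∈ D.powerset, wtW D p K * ind {K : Finset (Sym2 V) | (↑K : Set (Sym2 V)) ∈ Dv} K := by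
    rw [DecisionTree.prodBernoulli_real_eq_PrW w (hdet Dv) (X := {K : Finset (Sym2 V) | (↑K : Set (Sym2 V)) ∈ Dv})
      (fun S _ => Iff.rfl), PrW_eq_sum_ind]
  have eX : (prodBernoulli w).real (U ∩ Dv) =
      ∑ K ∈ D.powerset, wtW D p K * ind {K : Finset (Sym2 V) | (↑K : Set (Sym2 V)) ∈ U ∩ Dv} K := by
    rw [DecisionTree.prodBernoulli_real_eq_PrW w (hdet (U ∩ Dv)) (X := {K : Finset (Sym2 V) | (↑K : Set (Sym2 V)) ∈ U ∩ Dv})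
      (fun S _ => Iff.rfl), PrW_eq_sum_ind]
  -- indicator algebra, pointwise
  set Ib : Set (Finset (Sym2 V)) := {K | ¬ (openGraph (↑K : Set (Sym2 V))).Reachable a s ∧
      ¬ (openGraph (↑K : Set (Sym2 V))).Reachable a c} with hIb
  set SC : Set (Finset (Sym2 V)) := {C | (openGraph (↑C : Set (Sym2 V))).Reachable s c} with hSC
  set J3 : Set (Finset (Sym2 V)) := {K | (¬ (openGraph (↑K : Set (Sym2 V))).Reachable a s ∧
      ¬ (openGraph (↑K : Set (Sym2 V))).Reachable a c) ∧ (openGraph (↑K : Set (Sym2 V))).Reachable s c} with hJ3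
  have hmemU : ∀ K : Finset (Sym2 V), K ∈ {K : Finset (Sym2 V) | (↑K : Set (Sym2 V)) ∈ U} ↔ K ∉ Ib := by
    intro K
    simp only [hU, hIb, Set.mem_setOf_eq, Set.mem_union, openConn, not_and_or, not_not]
    constructor
    · rintro (h | h)
      · exact Or.inl h.symm
      · exact Or.inr h.symm
    · rintro (h | h)
      · exact Or.inl h.symm
      · exact Or.inr h.symm
  have hmemD : ∀ K : Finset (Sym2 V), K ∈ {K : Finset (Sym2 V) | (↑K : Set (Sym2 V)) ∈ Dv} ↔ K ∉ SC := by
    intro K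
    simp only [hDv, hSC, Set.mem_setOf_eq, Set.mem_compl_iff, openConn]
  have hmemX : ∀ K : Finset (Sym2 V), K ∈ {K : Finset (Sym2 V) | (↑K : Set (Sym2 V)) ∈ U ∩ Dv} ↔ K ∉ Ib ∧ K ∉ SC := by
    intro K
    rw [← hmemU K, ← hmemD K]
    simp only [Set.mem_setOf_eq, Set.mem_inter_iff]
  have pU : ∀ K, ind {K : Finset (Sym2 V) | (↑K : Set (Sym2 V)) ∈ U} K = 1 - ind Ib K := by
    intro K
    by_cases hK : K ∈ Ib
    · rw [ind_of_mem hK, ind_of_not_mem (fun h => (hmemU K).1 h hK)]; ring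
    · rw [ind_of_not_mem hK, ind_of_mem ((hmemU K).2 hK)]; ring
  have pD : ∀ K, ind {K : Finset (Sym2 V) | (↑K : Set (Sym2 V)) ∈ Dv} K = 1 - ind SC K := by
    intro K
    by_cases hK : K ∈ SC
    · rw [ind_of_mem hK, ind_of_not_mem (fun h => (hmemD K).1 h hK)]; ring
    · rw [ind_of_not_mem hK, ind_of_mem ((hmemD K).2 hK)]; ring
  have pX : ∀ K, ind {K : Finset (Sym2 V) | (↑K : Set (Sym2 V)) ∈ U ∩ Dv} K = 1 - ind Ib K - ind SC K + ind J3 K := by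
    intro K
    have hJ3' : K ∈ J3 ↔ K ∈ Ib ∧ K ∈ SC := by simp only [hJ3, hIb, hSC, Set.mem_setOf_eq]
    by_cases hK : K ∈ Ib <;> by_cases hK' : K ∈ SC
    · rw [ind_of_mem hK, ind_of_mem hK', ind_of_mem (hJ3'.2 ⟨hK, hK'⟩),
        ind_of_not_mem (fun h => ((hmemX K).1 h).1 hK)]; ring
    · rw [ind_of_mem hK, ind_of_not_mem hK', ind_of_not_mem (fun h => hK' (hJ3'.1 h).2),
        ind_of_not_mem (fun h => ((hmemX K).1 h).1 hK)]; ring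
    · rw [ind_of_not_mem hK, ind_of_mem hK', ind_of_not_mem (fun h => hK (hJ3'.1 h).1),
        ind_of_not_mem (fun h => ((hmemX K).1 h).2 hK')]; ring
    · rw [ind_of_not_mem hK, ind_of_not_mem hK', ind_of_not_mem (fun h => hK (hJ3'.1 h).1),
        ind_of_mem ((hmemX K).2 ⟨hK, hK'⟩)]; ring
  -- the sums
  have hone : ∑ K ∈ D.powerset, wtW D p K = 1 := sum_wtW D p
  set Iv := ∑ K ∈ D.powerset, wtW D p K * ind Ib K with hIv
  set σv := ∑ K ∈ D.powerset, wtW D p K * ind SC K with hσv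
  set jv := ∑ K ∈ D.powerset, wtW D p K * ind J3 K with hjv
  have sU : (prodBernoulli w).real U = 1 - Iv := by
    rw [eU, hIv, ← hone, ← Finset.sum_sub_distrib]
    refine Finset.sum_congr rfl fun K _ => ?_
    rw [pU]; ring
  have sD : (prodBernoulli w).real Dv = 1 - σv := by
    rw [eD, hσv, ← hone, ← Finset.sum_sub_distrib]
    refine Finset.sum_congr rfl fun K _ => ?_
    rw [pD]; ring
  have sX : (prodBernoulli w).real (U ∩ Dv) = 1 - Iv - σv + jv := by
    rw [eX, hIv, hσv, hjv, ← hone, ← Finset.sum_sub_distrib, ← Finset.sum_sub_distrib, ← Finset.sum_add_distrib]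
    refine Finset.sum_congr rfl fun K _ => ?_
    rw [pX]; ring
  -- the resampling bound
  have key := sum_notU_mul_sum_conn_le hp0 hp1 s a c
  rw [← hIv, ← hσv, ← hjv] at key
  rw [sX] at hW
  rw [sU, sD, sX]
  nlinarith [key, hW]

end HalvingResample

end Summit.CriticalPhenomena.PercolationContinuityZ3.Theorems
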